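import Summits.CriticalPhenomena.CardyFormulaZ2.Theorems.CardyComplexConeParafermionToSLESixFamiliesDiamondDefs
import HarnessLib

/-!
# Every marked diamond has a free boundary segment (the geometric half of S3 (c))

Crux `ParafermionToSLESixFamilies` (stmt-CriticalPhenomena-11389), route `CardyComplexCone`, line
`potential-darboux-picard-diamond`, stub S3 `stub_closedPrecompactness : ClosedPrecompactness`
(`…DiamondDefs.lean`). Conjunct (c) of `ClosedPrecompactness` (the non-degeneracy input N of the line) asks,
along every admissible family of a marked diamond `D`, for an ORIENTED BOUNDARY SEGMENT `[p, q]` of `D`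
(`IsBdrySegment D p q`: non-degenerate, on the frontier, no mark in its relative interior, the carrier on its
left) contained in the FREE arc `D.arc 1`, whose middle half carries renormalised touch mass `≥ c₀ > 0`
eventually. This file proves, sorry-free, the deterministic geometric half of that conjunct, which every
probabilistic lower bound must start from:

* `exists_isBdrySegment_subset_arc_one_of_isMarkedDiamond` — **every marked diamond has a free boundary
  segment**: `IsMarkedDiamond D → ∃ p q, IsBdrySegment D p q ∧ segment ℝ p q ⊆ D.arc 1`.

Proof. The frontier of the open tilted rectangle lies in the union of its four side LINES
`Re((z-c)e^{-iπ/4}) = ±α`, `Im((z-c)e^{-iπ/4}) = ±β`, the carrier lying strictly on one side of each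
(`frontier ⊆ closure ∖ carrier`). The free arc is the image of the parameter window `[mark 1, mark 0 + 1]`,
on which the `1`-periodic boundary loop is injective (`boundary_injOn_freeArcWindow`, from the tree's
`JordanDomain.injOn_boundary_Ico`). A compact
non-degenerate sub-window is covered by the four closed preimages of the side lines, so one of them contains
a non-degenerate interval (`exists_Icc_subset_of_subset_union`, no Baire category needed); on it the loop runs
inside one line, hence covers the straight segment between its endpoints (`segment_subset_image_of_line`,
intermediate value theorem for the coordinate along the line), the marks are excluded by injectivity, and
the orientation with the carrier on the left is read off the sign of one imaginary part
(`exists_isBdrySegment_of_straightWindow`, stated for an arbitrary Dobrushin domain lying on one side of a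
line along which a free parameter window runs — the form in which the probabilistic half will localise the
segment near a mark or inside a side).

What this does NOT give: the touch-mass lower bound itself (conjunct (c) proper), which is the diagonal
half-plane one-arm lower bound `FlipInvolutionReturnLaw.DiagHalfPlaneOneArmLower` (conditional on
`Literature.Probability.Percolation.IkhlefPonsaingFirstPassage`, `diagArmLower_of_ikhlefPonsaing`) glued to
`touchProb` by the tree's half-plane U-catch (`Literature.Probability.Percolation.HalfPlaneArm.uCatch`,
`real_U_ge`, `diag_rswLR/TB`, Harris–FKG) through the local lattice structure of an admissible
discretisation near a straight diagonal side — see the stub report of S3.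
-/

noncomputable section

namespace Summit.CriticalPhenomena.CardyFormulaZ2.Cruxes.ParafermionToSLESixFamilies.PotentialDarbouxPicardDiamond

open scoped Topology
open Filter Set Metric Complex
open Literature.Probability.RandomPlanarGeometry

/-! ## §1 Two elementary lemmas -/

/-- If a non-degenerate compact interval is covered by a closed set `C` and a set `R`, then some
non-degenerate compact sub-interval lies inside `C` or inside `R` (if the interval is not inside `C`, a point
of it off `C` has a neighbourhood off `C`, hence inside `R`). -/
theorem exists_Icc_subset_of_subset_union {a b : ℝ} (hab : a < b) {C R : Set ℝ} (hC : IsClosed C)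
    (h : Icc a b ⊆ C ∪ R) :
    ∃ a' b' : ℝ, a' < b' ∧ Icc a' b' ⊆ Icc a b ∧ (Icc a' b' ⊆ C ∨ Icc a' b' ⊆ R) := by
  by_cases hall : Icc a b ⊆ C
  · exact ⟨a, b, hab, Subset.rfl, Or.inl hall⟩
  obtain ⟨x, hx, hxC⟩ := not_subset.1 hall
  obtain ⟨ε, hε, hball⟩ := Metric.isOpen_iff.1 hC.isOpen_compl x hxC
  have key : ∀ y ∈ Icc a b, dist y x < ε → y ∈ R := fun y hy hyx =>
    (h hy).resolve_left (hball hyx)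
  rcases lt_or_ge x b with hxb | hbx
  · refine ⟨x, min b (x + ε / 2), lt_min hxb (by linarith), Icc_subset_Icc hx.1 (min_le_left _ _),
      Or.inr fun y hy => key y ⟨hx.1.trans hy.1, hy.2.trans (min_le_left _ _)⟩ ?_⟩
    rw [Real.dist_eq, abs_lt]
    constructor <;> linarith [hy.1, hy.2.trans (min_le_right _ _)]
  · have hxb' : x = b := le_antisymm hx.2 hbx
    refine ⟨max a (x - ε / 2), x, max_lt (hxb' ▸ hab) (by linarith), Icc_subset_Icc (le_max_left _ _) hx.2,
      Or.inr fun y hy => key y ⟨(le_max_left _ _).trans hy.1, hy.2.trans hx.2⟩ ?_⟩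
    rw [Real.dist_eq, abs_lt]
    constructor <;> linarith [hy.2, (le_max_right _ _).trans hy.1]

/-- A continuous path running inside a straight line `{z | Re((z - c)·μ) = κ}` (`μ ≠ 0`) covers the straight
segment between its endpoints (intermediate value theorem for the coordinate `Im((z - c)·μ)` along the line,
which determines the point of the line). -/
theorem segment_subset_image_of_line {γ : ℝ → ℂ} {s t : ℝ} (hst : s ≤ t) (hγ : ContinuousOn γ (Icc s t))
    {μ c : ℂ} (hμ : μ ≠ 0) {κ : ℝ} (hline : ∀ r ∈ Icc s t, ((γ r - c) * μ).re = κ) :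
    segment ℝ (γ s) (γ t) ⊆ γ '' Icc s t := by
  rintro _ ⟨a, b, ha, hb, hab, rfl⟩
  have hs' := hline s (left_mem_Icc.2 hst)
  have ht' := hline t (right_mem_Icc.2 hst)
  -- the point of the segment in the coordinates of the line
  have e : (a • γ s + b • γ t - c) * μ = (a : ℂ) * ((γ s - c) * μ) + (b : ℂ) * ((γ t - c) * μ) := by
    have hab' : (a : ℂ) + (b : ℂ) = 1 := by exact_mod_cast hab
    simp only [Complex.real_smul]
    linear_combination (c * μ) * hab'
  have hre : ((a • γ s + b • γ t - c) * μ).re = κ := by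
    rw [e, Complex.add_re, Complex.re_ofReal_mul, Complex.re_ofReal_mul, hs', ht', ← add_mul, hab, one_mul]
  have him : ((a • γ s + b • γ t - c) * μ).im = a * ((γ s - c) * μ).im + b * ((γ t - c) * μ).im := by
    rw [e, Complex.add_im, Complex.im_ofReal_mul, Complex.im_ofReal_mul]
  -- intermediate value theorem for the coordinate along the line
  have hcont : ContinuousOn (fun r => ((γ r - c) * μ).im) (uIcc s t) := by
    rw [uIcc_of_le hst]
    exact Complex.continuous_im.comp_continuousOn ((hγ.sub continuousOn_const).mul continuousOn_const)
  have hmem : ((a • γ s + b • γ t - c) * μ).im ∈ uIcc (((γ s - c) * μ).im) (((γ t - c) * μ).im) := by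
    rw [him, ← segment_eq_uIcc]
    exact ⟨a, b, ha, hb, hab, by simp [smul_eq_mul]⟩
  obtain ⟨r, hr, hrval⟩ := intermediate_value_uIcc hcont hmem
  rw [uIcc_of_le hst] at hr
  refine ⟨r, hr, ?_⟩
  have heq : (γ r - c) * μ = (a • γ s + b • γ t - c) * μ :=
    Complex.ext (by rw [hline r hr, hre]) hrval
  simpa using mul_right_cancel₀ hμ heq

/-! ## §2 The free-arc parameter window of a Dobrushin domain -/

/-- The free arc `D.arc 1 = (ba)` is the image of the parameter window `[mark 1, mark 0 + 1]`
(`MarkedDomain.nextMark_one_two`). -/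
theorem arc_one_eq_image_Icc (D : DobrushinDomain) :
    D.arc 1 = D.boundary '' Icc (D.mark 1) (D.mark 0 + 1) := by
  rw [MarkedDomain.arc, MarkedDomain.nextMark_one_two]

/-- The `1`-periodic boundary loop is injective on the free-arc parameter window `[mark 1, mark 0 + 1]`
(a sub-interval of the period `[mark 1, mark 1 + 1)`, `JordanDomain.injOn_boundary_Ico`). -/
theorem boundary_injOn_freeArcWindow (D : DobrushinDomain) :
    InjOn D.boundary (Icc (D.mark 1) (D.mark 0 + 1)) :=
  (D.injOn_boundary_Ico (D.mark 1)).mono (Icc_subset_Ico_right (by linarith [D.mark_zero_lt_mark_one]))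

/-! ## §3 From a straight free parameter window to an oriented free boundary segment -/

/-- The sign identity behind the orientation clause of `IsBdrySegment`: if `(q - p)·μ = i·m` is purely
imaginary in the direction `μ`, then for every `z`,
`Im((z - p)·conj(q - p)) · |μ|² = -m · Re((z - p)·μ)`. -/
theorem im_mul_conj_mul_normSq_eq {p q μ : ℂ} {m : ℝ} (hpq : (q - p) * μ = I * m) (z : ℂ) :
    ((z - p) * (starRingEnd ℂ) (q - p)).im * Complex.normSq μ = -m * ((z - p) * μ).re := by
  have h1 := congrArg Complex.re hpq
  have h2 := congrArg Complex.im hpq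
  simp only [Complex.mul_re, Complex.mul_im, Complex.I_re, Complex.I_im, Complex.ofReal_re,
    Complex.ofReal_im, zero_mul, mul_zero, sub_zero, one_mul, zero_add] at h1 h2
  simp only [Complex.mul_im, Complex.mul_re, Complex.conj_re, Complex.conj_im, Complex.normSq_apply]
  linear_combination ((z - p).im * μ.re + (z - p).re * μ.im) * h1 - ((z - p).re * μ.re - (z - p).im * μ.im) * h2

/-- **A straight free parameter window yields an oriented free boundary segment.** Let the Dobrushin domain
`D` lie strictly on one side of the line `{Re((z - c)·μ) = κ}` (`μ ≠ 0`), and let the boundary loop run inside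
that line on a non-degenerate parameter window `[s, t]` strictly inside the free-arc window
`(mark 1, mark 0 + 1)`. Then the straight segment between `boundary s` and `boundary t`, suitably oriented, is
an oriented boundary segment of `D` contained in the free arc `D.arc 1`. -/
theorem exists_isBdrySegment_of_straightWindow (D : DobrushinDomain) {μ c : ℂ} (hμ : μ ≠ 0) {κ : ℝ}
    (hcar : ∀ z ∈ D.carrier, ((z - c) * μ).re < κ) {s t : ℝ} (hst : s < t) (hs : D.mark 1 < s)
    (ht : t < D.mark 0 + 1) (hline : ∀ r ∈ Icc s t, ((D.boundary r - c) * μ).re = κ) :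
    ∃ p q : ℂ, IsBdrySegment D p q ∧ segment ℝ p q ⊆ D.arc 1 ∧
      segment ℝ p q = segment ℝ (D.boundary s) (D.boundary t) := by
  have hinj := boundary_injOn_freeArcWindow D
  have hIJ : Icc s t ⊆ Icc (D.mark 1) (D.mark 0 + 1) := Icc_subset_Icc hs.le ht.le
  have hsJ : s ∈ Icc (D.mark 1) (D.mark 0 + 1) := hIJ (left_mem_Icc.2 hst.le)
  have htJ : t ∈ Icc (D.mark 1) (D.mark 0 + 1) := hIJ (right_mem_Icc.2 hst.le)
  have hne : D.boundary s ≠ D.boundary t := fun h => hst.ne (hinj hsJ htJ h)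
  have hseg : segment ℝ (D.boundary s) (D.boundary t) ⊆ D.boundary '' Icc s t :=
    segment_subset_image_of_line hst.le D.continuous_boundary.continuousOn hμ hline
  have harc : segment ℝ (D.boundary s) (D.boundary t) ⊆ D.arc 1 := by
    rw [arc_one_eq_image_Icc]
    exact hseg.trans (image_mono hIJ)
  have hfront : segment ℝ (D.boundary s) (D.boundary t) ⊆ frontier D.carrier := fun y hy => by
    obtain ⟨r, -, rfl⟩ := hseg hy
    exact D.boundary_mem_frontier r
  -- the marks are off the closed segment, by injectivity on the free-arc window
  have hmark : ∀ m ∈ Icc (D.mark 1) (D.mark 0 + 1), m ∉ Icc s t →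
      D.boundary m ∉ segment ℝ (D.boundary s) (D.boundary t) := by
    intro m hm hmst hmem
    obtain ⟨r, hr, hrm⟩ := hseg hmem
    exact hmst (hinj (hIJ hr) hm hrm ▸ hr)
  have hmark_le : D.mark 1 ≤ D.mark 0 + 1 := hsJ.1.trans hsJ.2
  have hpt1 : D.pt 1 ∉ segment ℝ (D.boundary s) (D.boundary t) :=
    hmark (D.mark 1) ⟨le_rfl, hmark_le⟩ fun h => (not_le.2 hs) h.1
  have hpt0 : D.pt 0 ∉ segment ℝ (D.boundary s) (D.boundary t) := by
    have e : D.pt 0 = D.boundary (D.mark 0 + 1) := (D.periodic_boundary (D.mark 0)).symm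
    rw [e]
    exact hmark (D.mark 0 + 1) ⟨hmark_le, le_rfl⟩ fun h => (not_le.2 ht) h.2
  -- the direction of the window inside the line
  set w : ℂ := D.boundary t - D.boundary s with hw
  have hwre : (w * μ).re = 0 := by
    have e : w * μ = (D.boundary t - c) * μ - (D.boundary s - c) * μ := by rw [hw]; ring
    rw [e, Complex.sub_re, hline s (left_mem_Icc.2 hst.le), hline t (right_mem_Icc.2 hst.le), sub_self]
  set m : ℝ := (w * μ).im with hm
  have hwμ : w * μ = I * m := Complex.ext (by simp [hwre]) (by simp [hm])
  have hm0 : m ≠ 0 := by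
    intro h0
    have h : w * μ = 0 := by rw [hwμ, h0]; simp
    rcases mul_eq_zero.1 h with h | h
    · exact hne (sub_eq_zero.1 h).symm
    · exact hμ h
  -- the carrier is on the left of the correctly oriented segment
  have orient : ∀ p q : ℂ, ((p - c) * μ).re = κ → ∀ m' : ℝ, 0 < m' → (q - p) * μ = I * m' →
      ∀ z ∈ D.carrier, 0 < ((z - p) * (starRingEnd ℂ) (q - p)).im := by
    intro p q hp m' hm' hpq z hz
    have key := im_mul_conj_mul_normSq_eq hpq z
    have hneg : ((z - p) * μ).re < 0 := by
      have e : (z - p) * μ = (z - c) * μ - (p - c) * μ := by ring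
      rw [e, Complex.sub_re, hp]
      linarith [hcar z hz]
    have hpos : 0 < ((z - p) * (starRingEnd ℂ) (q - p)).im * Complex.normSq μ := by
      rw [key]; nlinarith
    exact pos_of_mul_pos_left hpos (Complex.normSq_nonneg μ)  -- hmm
  rcases lt_or_gt_of_ne hm0 with hneg | hpos
  · -- orient from `boundary t` to `boundary s`
    refine ⟨D.boundary t, D.boundary s, ⟨hne.symm, ?_, ?_, ?_, ?_⟩, ?_, segment_symm ℝ _ _⟩
    · rw [segment_symm]; exact hfront
    · rw [openSegment_symm]; exact fun h => hpt0 (openSegment_subset_segment ℝ _ _ h)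
    · rw [openSegment_symm]; exact fun h => hpt1 (openSegment_subset_segment ℝ _ _ h)
    · refine orient _ _ (hline t (right_mem_Icc.2 hst.le)) (-m) (by linarith) ?_
      rw [show D.boundary s - D.boundary t = -w by rw [hw]; ring, neg_mul, hwμ]
      push_cast
      ring
    · rw [segment_symm]; exact harc
  · refine ⟨D.boundary s, D.boundary t, ⟨hne, hfront, ?_, ?_, ?_⟩, harc, rfl⟩
    · exact fun h => hpt0 (openSegment_subset_segment ℝ _ _ h)
    · exact fun h => hpt1 (openSegment_subset_segment ℝ _ _ h)
    · exact orient _ _ (hline s (left_mem_Icc.2 hst.le)) m hpos hwμ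

/-! ## §4 Marked diamonds -/

/-- **Every marked diamond has a free boundary segment**: for `D` a marked diamond (`IsMarkedDiamond`:
the carrier is an open rectangle with sides parallel to the lattice diagonals, marks anywhere on the
boundary) there are `p ≠ q` with `IsBdrySegment D p q` and `segment ℝ p q ⊆ D.arc 1` — the existential
datum of conjunct (c) of `ClosedPrecompactness`. -/
theorem exists_isBdrySegment_subset_arc_one_of_isMarkedDiamond : ∀ (D : DobrushinDomain), IsMarkedDiamond D → ∃ p q : ℂ, IsBdrySegment D p q ∧ segment ℝ p q ⊆ D.arc 1 := by
  intro D hD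
  obtain ⟨c, α, β, hα, hβ, hcar⟩ := hD
  have mem : ∀ z : ℂ, z ∈ D.carrier ↔
      |((z - c) * exp (-(Real.pi / 4 : ℝ) * I)).re| < α ∧ |((z - c) * exp (-(Real.pi / 4 : ℝ) * I)).im| < β :=
    fun z => Set.ext_iff.1 hcar z
  set E : ℂ := exp (-(Real.pi / 4 : ℝ) * I) with hE
  have hE0 : E ≠ 0 := Complex.exp_ne_zero _
  -- the frontier lies in the union of the four side lines
  have hclos : closure D.carrier ⊆ {z | |((z - c) * E).re| ≤ α ∧ |((z - c) * E).im| ≤ β} := by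
    refine closure_minimal (fun z hz => ?_) ?_
    · obtain ⟨h1, h2⟩ := (mem z).1 hz
      exact ⟨h1.le, h2.le⟩
    · have hc : Continuous fun z : ℂ => (z - c) * E := (continuous_id.sub continuous_const).mul continuous_const
      exact (isClosed_le (continuous_abs.comp (Complex.continuous_re.comp hc)) continuous_const).inter
        (isClosed_le (continuous_abs.comp (Complex.continuous_im.comp hc)) continuous_const)
  have hfr : ∀ z ∈ frontier D.carrier, ((z - c) * E).re = α ∨ ((z - c) * E).re = -α ∨
      ((z - c) * E).im = β ∨ ((z - c) * E).im = -β := by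
    intro z hz
    obtain ⟨h1a, h1b⟩ := hclos (frontier_subset_closure hz)
    have h2 : z ∉ D.carrier := fun h => by
      have : z ∈ D.carrier ∩ frontier D.carrier := ⟨h, hz⟩
      rw [D.isOpen.inter_frontier_eq] at this
      exact this
    by_contra hcon
    push Not at hcon
    refine h2 ((mem z).2 ⟨lt_of_le_of_ne h1a fun habs => ?_, lt_of_le_of_ne h1b fun habs => ?_⟩)
    · rcases (abs_eq hα.le).1 habs with h | h
      exacts [hcon.1 h, hcon.2.1 h]
    · rcases (abs_eq hβ.le).1 habs with h | h
      exacts [hcon.2.2.1 h, hcon.2.2.2 h]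
  -- the four closed parameter sets of the sides
  have hcont : Continuous fun r : ℝ => (D.boundary r - c) * E :=
    (D.continuous_boundary.sub continuous_const).mul continuous_const
  have hC₁ : IsClosed {r : ℝ | ((D.boundary r - c) * E).re = α} :=
    isClosed_eq (Complex.continuous_re.comp hcont) continuous_const
  have hC₂ : IsClosed {r : ℝ | ((D.boundary r - c) * E).re = -α} :=
    isClosed_eq (Complex.continuous_re.comp hcont) continuous_const
  have hC₃ : IsClosed {r : ℝ | ((D.boundary r - c) * E).im = β} :=
    isClosed_eq (Complex.continuous_im.comp hcont) continuous_const
  -- a compact window strictly inside the free-arc parameter window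
  have hm0 := D.mark_mem 0
  have hm1 := D.mark_mem 1
  have hlen : 0 < D.mark 0 + 1 - D.mark 1 := by linarith [hm1.2, hm0.1]
  set s₀ : ℝ := D.mark 1 + (D.mark 0 + 1 - D.mark 1) / 3 with hs₀
  set t₀ : ℝ := D.mark 0 + 1 - (D.mark 0 + 1 - D.mark 1) / 3 with ht₀
  have hs₀' : D.mark 1 < s₀ := by rw [hs₀]; linarith
  have ht₀' : t₀ < D.mark 0 + 1 := by rw [ht₀]; linarith
  have hst₀ : s₀ < t₀ := by rw [hs₀, ht₀]; linarith
  have hcover : Icc s₀ t₀ ⊆ {r : ℝ | ((D.boundary r - c) * E).re = α} ∪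
      ({r : ℝ | ((D.boundary r - c) * E).re = -α} ∪ ({r : ℝ | ((D.boundary r - c) * E).im = β} ∪
        {r : ℝ | ((D.boundary r - c) * E).im = -β})) := fun r _ => by
    rcases hfr (D.boundary r) (D.boundary_mem_frontier r) with h | h | h | h
    exacts [Or.inl h, Or.inr (Or.inl h), Or.inr (Or.inr (Or.inl h)), Or.inr (Or.inr (Or.inr h))]
  -- the real parts of the four side functionals on the carrier
  have reNeg : ∀ z : ℂ, ((z - c) * -E).re = -((z - c) * E).re := fun z => by rw [mul_neg, Complex.neg_re]
  have reNegI : ∀ z : ℂ, ((z - c) * (E * -I)).re = ((z - c) * E).im := fun z => by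
    rw [← mul_assoc]; simp
  have reI : ∀ z : ℂ, ((z - c) * (E * I)).re = -((z - c) * E).im := fun z => by
    rw [← mul_assoc]; simp
  have car₁ : ∀ z ∈ D.carrier, ((z - c) * E).re < α := fun z hz => (abs_lt.1 ((mem z).1 hz).1).2
  have car₂ : ∀ z ∈ D.carrier, ((z - c) * -E).re < α := fun z hz => by
    rw [reNeg]; linarith [(abs_lt.1 ((mem z).1 hz).1).1]
  have car₃ : ∀ z ∈ D.carrier, ((z - c) * (E * -I)).re < β := fun z hz => by
    rw [reNegI]; exact (abs_lt.1 ((mem z).1 hz).2).2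
  have car₄ : ∀ z ∈ D.carrier, ((z - c) * (E * I)).re < β := fun z hz => by
    rw [reI]; linarith [(abs_lt.1 ((mem z).1 hz).2).1]
  have hI0 : E * -I ≠ 0 := mul_ne_zero hE0 (neg_ne_zero.2 I_ne_zero)
  have hI0' : E * I ≠ 0 := mul_ne_zero hE0 I_ne_zero
  -- conclude from a straight window
  have finish : ∀ {μ : ℂ}, μ ≠ 0 → ∀ {κ : ℝ}, (∀ z ∈ D.carrier, ((z - c) * μ).re < κ) →
      ∀ {a b : ℝ}, a < b → Icc a b ⊆ Icc s₀ t₀ → (∀ r ∈ Icc a b, ((D.boundary r - c) * μ).re = κ) →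
      ∃ p q : ℂ, IsBdrySegment D p q ∧ segment ℝ p q ⊆ D.arc 1 := by
    intro μ hμ κ hκ a b hab hsub hl
    have ha : D.mark 1 < a := hs₀'.trans_le (hsub (left_mem_Icc.2 hab.le)).1
    have hb : b < D.mark 0 + 1 := (hsub (right_mem_Icc.2 hab.le)).2.trans_lt ht₀'
    obtain ⟨p, q, hpq, hsub', -⟩ := exists_isBdrySegment_of_straightWindow D hμ hκ hab ha hb hl
    exact ⟨p, q, hpq, hsub'⟩
  -- peel off the four sides one at a time
  obtain ⟨a₁, b₁, hab₁, hsub₁, h₁ | h₁⟩ := exists_Icc_subset_of_subset_union hst₀ hC₁ hcover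
  · exact finish hE0 car₁ hab₁ hsub₁ fun r hr => h₁ hr
  obtain ⟨a₂, b₂, hab₂, hsub₂, h₂ | h₂⟩ := exists_Icc_subset_of_subset_union hab₁ hC₂ h₁
  · exact finish (neg_ne_zero.2 hE0) car₂ hab₂ (hsub₂.trans hsub₁) fun r hr => by
      rw [reNeg, show ((D.boundary r - c) * E).re = -α from h₂ hr, neg_neg]
  obtain ⟨a₃, b₃, hab₃, hsub₃, h₃ | h₃⟩ := exists_Icc_subset_of_subset_union hab₂ hC₃ h₂
  · exact finish hI0 car₃ hab₃ (hsub₃.trans (hsub₂.trans hsub₁)) fun r hr => by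
      rw [reNegI]; exact h₃ hr
  · exact finish hI0' car₄ hab₃ (hsub₃.trans (hsub₂.trans hsub₁)) fun r hr => by
      rw [reI, show ((D.boundary r - c) * E).im = -β from h₃ hr, neg_neg]

end Summit.CriticalPhenomena.CardyFormulaZ2.Cruxes.ParafermionToSLESixFamilies.PotentialDarbouxPicardDiamond

end
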